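import Literature.Probability.RandomPlanarGeometry.LoewnerReflection
import HarnessLib

/-!
# [LSW] Thm. 6.1 for smooth hulls and for one-sided hulls: smooth hulls, Lemma 6.3, Lemma 2.1

Level 4 of the decomposition of the named fact `Literature.Probability.RandomPlanarGeometry.sle_restriction_eightThirds`
(`RestrictionHulls`; plan in `SLERestrictionMartingale`), after

* G. F. Lawler, O. Schramm, W. Werner, *Conformal restriction: the chordal case*, J. Amer. Math.
  Soc. **16** (2003) 917–955, arXiv:math/0209343 (**[LSW]**), §2 p. 8 (smooth hulls,
  Lemma 2.1), §6 (Lemma 6.3, proof of Thm. 6.1).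

The proof of Thm. 6.1 (§6): "By Proposition 3.3, it suffices to consider the case where `A` is
a smooth hull in `𝒬₊ ∪ 𝒬₋`. By symmetry, we may take `A ∈ 𝒬₊`. … Lemmas 6.2 and 6.3 show that
`Y_T = 1_{T=∞}` a.s." This file assembles the theorem for SMOOTH hulls from the three printed
inputs vendored upstream and here (Prop. 5.2/5.3: `sle_exists_isRestrictionMartingale`;
Lemma 6.2: `Loewner.restrictionDeriv_exitTime_gt`; Lemma 6.3: vendored here), and then for ALL
hulls of `𝒬₊ ∪ 𝒬₋` by the smooth approximation of Lemma 2.1 — for the law of the SLE_{8/3}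
trace this is the content of the reduction "by Proposition 3.3" ((4) ⇒ (3) there, "using Lemma
2.1") restricted to one-sided hulls. Contents:

* `Literature.IsSmoothHull A` — **smooth hull**, [LSW] §2 p. 8 verbatim: "We will call `A ∈ 𝒬` a
  *smooth hull* if there is a smooth curve `γ : [0,1] → ℍ̄` with `γ(0), γ(1) ∈ ℝ`,
  `γ(0,1) ⊂ ℍ`, `γ(0,1)` has no self-intersections, and `ℍ ∩ ∂A = γ(0,1)`." Read with
  "smooth curve" in the classical sense of complex analysis — `γ` continuously differentiable
  on `[0, 1]` (Conway, *Functions of One Complex Variable I* (1978), §III.3 Def. 3.1: "if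
  `γ'(t)` exists for each `t` in `[a,b]` and `γ' : [a,b] → ℂ` is continuous then `γ` is a
  smooth path") with nowhere-vanishing velocity (a regular arc) — and, as in the tree's
  topological variant `IsArcHull` (`HullApproximation`, where smoothness is dropped), with `γ`
  injective on the closed interval; `IsSmoothHull A → IsArcHull A`. This is the regularity of
  [LSW]'s own smooth approximants (the hulls `E_δ` of the proof of Lemma 3.5, p. 13, bounded
  in `ℍ` by the conformal image of the boundary of a stadium — a `C¹` arc with Lipschitz
  tangent, not `C²`), and it is what the printed proof of Lemma 6.3 uses ("`β'(1)` orthogonal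
  to `∂A` at `z₀`. By smoothness of `A ∩ ℍ`, there is some small disk `D` with center `z₀`
  such that `D ∩ A` consists of exactly two points": a tangent at the hitting point and the
  local structure of a regular `C¹` arc).
* `Literature.Probability.RandomPlanarGeometry.IsSmoothHull.restrictionDerivVanishesAtHit` — NAMED FACT, **[LSW] Lemma 6.3**: every
  smooth `*`-hull has the property `Loewner.RestrictionDerivVanishesAtHit`
  (`SLERestrictionLemmas`: for every continuous driving function whose hulls first meet `A` at
  `T < ∞` with `K_T ∩ A ∩ ℝ = ∅`, `Φ'_{A_t}(W_t) → 0` as `t ↗ T`).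
* `Literature.Probability.RandomPlanarGeometry.IsPlusHull.exists_antitone_isSmoothHull` — NAMED FACT, **[LSW] Lemma 2.1** in its
  printed form (smooth hulls, decreasing, monotone convergence of the derivatives at `0`), with
  the reading conventions of the tree's packaged `HasArcApprox` (`HullApproximation`; `A ≠ ∅`,
  the intersection `F ⊇ A` adds to `A` only real points and misses `0` — the printed
  "`A = ⋂ A_n`" can only hold when `A ∩ ℝ` is an interval); the tree's `HasArcApprox`
  (proved in `ArcApproximation` with [LSW]'s hulls `E_δ`) concludes only `IsArcHull` but gives
  the uniform convergence of the maps.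
* PROVED: `Literature.Probability.RandomPlanarGeometry.IsSmoothHull.image_imagAxisRefl` (smooth hulls reflect), `Literature.Probability.RandomPlanarGeometry.HasSmoothApprox`
  with `hasSmoothApprox_of_plus_or_minus` (Lemma 2.1 for `𝒬₋` by the reflection `σ`, as [LSW]
  "by symmetry"), `Literature.Probability.RandomPlanarGeometry.sle_measure_disjoint_eq_of_isSmoothHull` — **Thm. 6.1 for smooth hulls
  in `𝒬₊ ∪ 𝒬₋`** — and `Literature.Probability.RandomPlanarGeometry.sle_measure_disjoint_eq_of_isPlusHull_or_isMinusHull` — **Thm. 6.1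
  for every `A ∈ 𝒬₊ ∪ 𝒬₋`**: with smooth `J_n ↓ F`, the events `{γ ∩ J_n = ∅}` increase to
  `{γ ∩ F = ∅}`, which is `{γ ∩ A = ∅}` up to a null set (the simple transient trace meets `ℝ`
  only at `0 ∉ F`, and a compact initial arc missing `F = ⋂ J_n` misses some `J_n`), while
  `Φ'_{J_n}(0)^{5/8} → Φ'_A(0)^{5/8}`.

The remaining hypotheses are the printed theorems: the restriction martingales (`hM`),
Lemmas 6.2/6.3 (`h62`, `h63`), Lemma 2.1 (`h21`), existence/uniqueness of `Φ_A` and of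
`Φ'_A(0)` (`huniq`, `hex`; both proved in the tree, `RestrictionHullsRiemannProofs`,
`RestrictionHullsProofs`), and the Rohde–Schramm / Lawler facts on the trace (`hgen`, `h₆`,
`htr`, `hswallow`). The two-sided hulls of `𝒬*` (the rest of the reduction "by Prop. 3.3") are
not treated in this file.
-/

noncomputable section

open Set Filter Topology MeasureTheory Metric
open UpperHalfPlane (upperHalfPlaneSet isOpen_upperHalfPlaneSet)
open scoped NNReal ENNReal

namespace Literature.Probability.RandomPlanarGeometry

variable {A : Set ℂ}

/-! ### Smooth hulls ([LSW] §2 p. 8) -/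

/-- **Smooth hull** ([LSW] §2 p. 8, verbatim): "We will call `A ∈ 𝒬` a *smooth hull* if there
is a smooth curve `γ : [0,1] → ℍ̄` with `γ(0), γ(1) ∈ ℝ`, `γ(0,1) ⊂ ℍ`, `γ(0,1)` has no
self-intersections, and `ℍ ∩ ∂A = γ(0,1)`." Reading: "smooth curve" in the classical sense of
complex analysis (Conway (1978), §III.3 Def. 3.1: `γ'` exists on `[0, 1]` and is continuous
there), with nowhere-vanishing velocity (a regular arc); formally, `γ` has a derivative `γ' t`
within `[0, 1]` at every `t ∈ [0, 1]` (one-sided at the endpoints, as in Conway's definition),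
`γ'` is continuous on `[0, 1]` and `γ' t ≠ 0`. As in the tree's topological variant `IsArcHull`
(`HullApproximation`), `γ` is injective on the CLOSED interval (so `γ(0) ≠ γ(1)`: the boundary
arc has two distinct real endpoints, as for the hulls [LSW] use, cf. the discussion at
`IsArcHull`). Thus `IsSmoothHull A` is `IsArcHull A` with a regular `C¹` parametrisation of the
arc — the regularity of [LSW]'s approximants `E_δ` (proof of Lemma 3.5, p. 13).
[cite: LawlerSchrammWerner2003Restriction, §2 p. 8 (smooth hulls)] -/
def IsSmoothHull (A : Set ℂ) : Prop :=
  IsBoundedHull A ∧ ∃ γ γ' : ℝ → ℂ, (∀ t ∈ Icc (0 : ℝ) 1, HasDerivWithinAt γ (γ' t) (Icc 0 1) t) ∧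
    ContinuousOn γ' (Icc 0 1) ∧ (∀ t ∈ Icc (0 : ℝ) 1, γ' t ≠ 0) ∧ InjOn γ (Icc 0 1) ∧
    (γ 0).im = 0 ∧ (γ 1).im = 0 ∧ (∀ t ∈ Ioo (0 : ℝ) 1, 0 < (γ t).im) ∧
    upperHalfPlaneSet ∩ frontier A = γ '' Ioo 0 1

/-- A smooth hull is a hull bounded by a Jordan arc (`IsArcHull`: forget the smoothness).
[folklore] -/
theorem IsSmoothHull.isArcHull (h : IsSmoothHull A) : IsArcHull A := by
  obtain ⟨hA, γ, γ', hγ, -, -, hinj, h0, h1, hI, hfr⟩ := h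
  exact ⟨hA, γ, fun t ht ↦ (hγ t ht).continuousWithinAt, hinj, h0, h1, hI, hfr⟩

/-- A smooth hull is a bounded hull. [folklore] -/
theorem IsSmoothHull.isBoundedHull (h : IsSmoothHull A) : IsBoundedHull A :=
  h.1

/-- **Smooth hulls reflect** (`σ(A)` is bounded by the reflected arc `σ ∘ γ`, again a regular
`C¹` arc: `(σ ∘ γ)' = σ₀(γ') ≠ 0` with `σ₀(v) = -v̄` the linear part of `σ`). [folklore] -/
theorem IsSmoothHull.image_imagAxisRefl (h : IsSmoothHull A) : IsSmoothHull (imagAxisRefl '' A) := by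
  obtain ⟨hA, γ, γ', hγ, hγ'c, hγ', hinj, h0, h1, hI, hfr⟩ := h
  refine ⟨hA.image_imagAxisRefl, fun t ↦ imagAxisRefl (γ t), fun t ↦ -((starRingEnd ℂ) (γ' t)),
    fun t ht ↦ ((hγ t ht).star).neg, (Complex.continuous_conj.comp_continuousOn hγ'c).neg,
    fun t ht ↦ by simpa using hγ' t ht, imagAxisRefl.injective.comp_injOn hinj, by simpa using h0,
    by simpa using h1, fun t ht ↦ by simpa using hI t ht, ?_⟩
  rw [← imagAxisRefl.image_frontier,
    show (fun t ↦ imagAxisRefl (γ t)) = imagAxisRefl ∘ γ from rfl, image_comp, ← hfr,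
    image_inter imagAxisRefl.injective, imagAxisRefl_image_upperHalfPlaneSet]

/-! ### [LSW] Lemma 6.3 (named fact) -/

/-- NAMED FACT — **[LSW] Lemma 6.3** (p. 14 of the arXiv version), verbatim: "Let
`W : [0, ∞) → ℝ` be continuous, let `g_t` be the corresponding solution of (2.5), and let `K_t`
be the associated growing hull. Let `A ∈ 𝒬*` be a smooth hull. Suppose that
`T := inf{t ≥ 0 : K_t ∩ A ≠ ∅} < ∞` and `K_T ∩ A ∩ ℝ = ∅`. Set `A_t := g_t(A)`, `t < T`. Then
`lim_{t ↗ T} Φ_{A_t}'(W_t) = 0`." Packaged as: every smooth `*`-hull has the property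
`Loewner.RestrictionDerivVanishesAtHit` of `SLERestrictionLemmas` (which spells out `T`, the
hypothesis `K_T ∩ A ∩ ℝ = ∅` as "no real point of `A` is swallowed by time `T`", and the limit
as "`Φ'_{A_t − W_t}(0) < ε` for `t < T` close to `T`, for all restriction data of the slid
hull"). Proof in print: harmonic measure from the two arcs of `∂A` at the hitting point and
[LSW] Prop. 4.1; not reproduced. [cite: LawlerSchrammWerner2003Restriction, Lemma 6.3] -/
def IsSmoothHull.restrictionDerivVanishesAtHit : Prop :=
  ∀ {A : Set ℂ}, IsSmoothHull A → IsStarHull A → Loewner.RestrictionDerivVanishesAtHit A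

/-! ### [LSW] Lemma 2.1 for smooth hulls (named fact) and its reflection -/

/-- NAMED FACT — **[LSW] Lemma 2.1** (p. 8), verbatim: "Suppose `A ∈ 𝒬₊`. Then there exists a
decreasing sequence of smooth hulls `(A_n)_{n ≥ 1}` such that `A = ⋂_{n=1}^∞ A_n` and the
increasing sequence `Φ'_{A_n}(0)` converges to `Φ'_A(0)`" (proof in print: "by considering the
image under `Φ_A⁻¹` of appropriately chosen paths"; the hulls `E_δ = cl(A ∪ Φ_A⁻¹(D_δ))` of the
proof of Lemma 3.5, p. 13). Stated with the reading conventions of the tree's packaged form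
`HasArcApprox` (`HullApproximation`, whose docstring discusses them): `A` is nonempty, the `A_n`
are smooth hulls of `𝒬₊`, and the printed "`A = ⋂ A_n`" — which can only hold when `A ∩ ℝ` is an
interval — is read as: the intersection `F` contains `A`, adds to `A` only real points
(`F ∩ ℍ ⊆ A`) and misses `0` (for the `E_δ`, `F = A ∪ [x, x₁]` is `A` with a real interval
`⊂ (0, ∞)` added); `Φ'(0)` is taken in the sense of `HasRestrictionDeriv` for any restriction
maps. Compared with `HasArcApprox`, the hulls here are SMOOTH (`IsSmoothHull`, as printed) and
the printed monotone convergence of the derivatives (rather than the convergence of the maps) is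
asserted. [cite: LawlerSchrammWerner2003Restriction, Lemma 2.1 (p. 8)] -/
def IsPlusHull.exists_antitone_isSmoothHull : Prop :=
  ∀ {A : Set ℂ}, IsPlusHull A → A.Nonempty →
    ∃ (J : ℕ → Set ℂ) (F : Set ℂ), (∀ n, IsSmoothHull (J n)) ∧ (∀ n, IsPlusHull (J n)) ∧
      Antitone J ∧ (⋂ n, J n) = F ∧ A ⊆ F ∧ F ∩ upperHalfPlaneSet ⊆ A ∧ (0 : ℂ) ∉ F ∧
      ∀ {Φ : ConformalEquiv (upperHalfPlaneSet \ A) upperHalfPlaneSet}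
        {Ψ : ∀ n, ConformalEquiv (upperHalfPlaneSet \ J n) upperHalfPlaneSet} {d : ℝ} {dn : ℕ → ℝ},
        IsRestrictionMap A Φ → HasRestrictionDeriv A Φ d →
        (∀ n, IsRestrictionMap (J n) (Ψ n)) → (∀ n, HasRestrictionDeriv (J n) (Ψ n) (dn n)) →
          Monotone dn ∧ Tendsto dn atTop (𝓝 d)

/-- **Outer approximation by smooth one-sided hulls with convergence of `Φ'(0)`** — the
conclusion of Lemma 2.1 in the form used below, symmetric under `σ`: decreasing smooth hulls
`J n ∈ 𝒬₊ ∪ 𝒬₋` whose intersection `F` contains `A`, adds only real points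
and misses `0`, with `Φ'_{J n}(0) → Φ'_A(0)` for all restriction data.
[cite: LawlerSchrammWerner2003Restriction, Lemma 2.1 (p. 8)] -/
def HasSmoothApprox (A : Set ℂ) : Prop :=
  ∃ (J : ℕ → Set ℂ) (F : Set ℂ), (∀ n, IsSmoothHull (J n)) ∧
    (∀ n, IsPlusHull (J n) ∨ IsMinusHull (J n)) ∧ Antitone J ∧ (⋂ n, J n) = F ∧ A ⊆ F ∧
    F ∩ upperHalfPlaneSet ⊆ A ∧ (0 : ℂ) ∉ F ∧
    ∀ (Φ : ConformalEquiv (upperHalfPlaneSet \ A) upperHalfPlaneSet)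
      (Ψ : ∀ n, ConformalEquiv (upperHalfPlaneSet \ J n) upperHalfPlaneSet) (d : ℝ) (dn : ℕ → ℝ),
      IsRestrictionMap A Φ → HasRestrictionDeriv A Φ d →
      (∀ n, IsRestrictionMap (J n) (Ψ n)) → (∀ n, HasRestrictionDeriv (J n) (Ψ n) (dn n)) →
        Tendsto dn atTop (𝓝 d)

/-- Lemma 2.1 for nonempty `A ∈ 𝒬₊`, packaged. [cite: LawlerSchrammWerner2003Restriction, Lemma 2.1 (p. 8)] -/
theorem IsPlusHull.hasSmoothApprox (h21 : IsPlusHull.exists_antitone_isSmoothHull)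
    (hA : IsPlusHull A) (hne : A.Nonempty) : HasSmoothApprox A := by
  obtain ⟨J, F, hJs, hJp, hJm, hJi, hAF, hFA, h0F, hconv⟩ := h21 hA hne
  exact ⟨J, F, hJs, fun n ↦ Or.inl (hJp n), hJm, hJi, hAF, hFA, h0F,
    fun Φ Ψ d dn hΦ hd hΨ hdn ↦ (hconv hΦ hd hΨ hdn).2⟩

/-- **Lemma 2.1 for nonempty `A ∈ 𝒬₋`, by the reflection `σ`** ("by symmetry"): reflect `A`
to `σ(A) ∈ 𝒬₊`, approximate, reflect the smooth hulls and the filling back; the derivatives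
`Φ'(0)` are `σ`-invariant (`HasRestrictionDeriv.reflectSet`).
[cite: LawlerSchrammWerner2003Restriction, Lemma 2.1 (p. 8) with §2 p. 8 (𝒬₋ = σ(𝒬₊))] -/
theorem IsMinusHull.hasSmoothApprox (h21 : IsPlusHull.exists_antitone_isSmoothHull)
    (hA : IsMinusHull A) (hne : A.Nonempty) : HasSmoothApprox A := by
  obtain ⟨J, F₀, hJs, hJp, hJm, hJi, hAF, hFA, h0F, hconv⟩ :=
    h21 hA.image_imagAxisRefl (hne.image _)
  refine ⟨fun n ↦ imagAxisRefl '' J n, imagAxisRefl '' F₀, fun n ↦ (hJs n).image_imagAxisRefl,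
    fun n ↦ Or.inr (hJp n).image_imagAxisRefl, fun m n hmn ↦ image_mono (hJm hmn), ?_, ?_, ?_,
    ?_, ?_⟩
  · rw [← image_iInter imagAxisRefl.bijective, hJi]
  · conv_lhs => rw [← imagAxisRefl_image_image A]
    exact image_mono hAF
  · rintro z ⟨⟨w, hw, rfl⟩, hzH⟩
    have hwH : w ∈ upperHalfPlaneSet := by simpa [upperHalfPlaneSet] using hzH
    have hwA : w ∈ imagAxisRefl '' A := hFA ⟨hw, hwH⟩
    rw [← imagAxisRefl_image_image A]
    exact mem_image_of_mem _ hwA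
  · rintro ⟨w, hw, hw0⟩
    have : w = 0 := by simpa using congrArg imagAxisRefl hw0
    rw [this] at hw
    exact h0F hw
  · intro Φ Ψ d dn hΦ hd hΨ hdn
    -- reflect the data: `σ ∘ Φ ∘ σ` for `σ(A)`, and data for `J n = σ(σ(J n))`
    have hΨ' : ∀ n, ∃ Ψ' : ConformalEquiv (upperHalfPlaneSet \ J n) upperHalfPlaneSet,
        IsRestrictionMap (J n) Ψ' ∧ HasRestrictionDeriv (J n) Ψ' (dn n) := fun n ↦
      exists_restrictionData_of_image (imagAxisRefl_image_image (J n)) (Ψ n) (hΨ n) (hdn n)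
    choose Ψ' hΨ'r hΨ'd using hΨ'
    exact (hconv hΦ.reflectSet hd.reflectSet hΨ'r hΨ'd).2

/-- Lemma 2.1, packaged, for nonempty `A ∈ 𝒬₊ ∪ 𝒬₋`. [cite: LawlerSchrammWerner2003Restriction, Lemma 2.1 (p. 8)] -/
theorem hasSmoothApprox_of_plus_or_minus (h21 : IsPlusHull.exists_antitone_isSmoothHull)
    (hA : IsPlusHull A ∨ IsMinusHull A) (hne : A.Nonempty) : HasSmoothApprox A :=
  hA.elim (fun h ↦ h.hasSmoothApprox h21 hne) (fun h ↦ h.hasSmoothApprox h21 hne)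

/-! ### [LSW] Thm. 6.1 for smooth hulls in `𝒬₊ ∪ 𝒬₋` -/

/-- **[LSW] Thm. 6.1 for a smooth hull `A ∈ 𝒬₊ ∪ 𝒬₋`**: `P[γ[0,∞) ∩ A = ∅] = Φ'_A(0)^{5/8}` —
the printed proof verbatim: the restriction martingale of `A` (Prop. 5.2/5.3, `hM`) converges
a.s. to `1_{T = ∞}` by Lemma 6.2 (`h62`, for `𝒬₊`; `𝒬₋` by symmetry, `LoewnerReflection`) and
Lemma 6.3 (`h63`, smooth hulls), applied along the SLE_{8/3} flow thanks to the Rohde–Schramm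
facts (the chain is generated by a simple transient trace: `hgen`, `h₆`, `htr`) and Lawler's
identification of swallowing with hitting (`hswallow`); then `E[Y_∞] = Y_0 = Φ'_A(0)^{5/8}`
(`IsRestrictionMartingale.measure_disjoint_eq_of_limits`, `SLERestrictionMartingale`).
[cite: LawlerSchrammWerner2003Restriction, Thm. 6.1 and its proof (§6), smooth one-sided case] -/
theorem sle_measure_disjoint_eq_of_isSmoothHull [Fact Process.isProjectiveLimit_preWienerMeasure]
    (huniq : IsStarHull.existsUnique_isRestrictionMap) (hM : sle_exists_isRestrictionMartingale)
    (h62 : Loewner.restrictionDeriv_exitTime_gt) (h63 : IsSmoothHull.restrictionDerivVanishesAtHit)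
    (hgen : HasSLETrace ((8 : ℝ≥0) / 3))
    (h₆ : RandomPlanarGeometry.ae_isSimpleTrace_sleTrace_of_le_four (κ := (8 : ℝ≥0) / 3))
    (htr : tendsto_norm_sleTrace_atTop) (hswallow : sle_swallowingTime_ofReal_eq_firstHit)
    (hA : IsSmoothHull A) (hA' : IsPlusHull A ∨ IsMinusHull A)
    {Φ : ConformalEquiv (upperHalfPlaneSet \ A) upperHalfPlaneSet} (hΦ : IsRestrictionMap A Φ)
    {d : ℝ} (hd : HasRestrictionDeriv A Φ d) :
    Process.preWienerMeasure {ω | Disjoint (range (sleTrace ((8 : ℝ≥0) / 3) ω)) A} =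
      ENNReal.ofReal (d ^ ((5 : ℝ) / 8)) := by
  have hAs : IsStarHull A := hA'.elim (fun h ↦ h.1) (fun h ↦ h.1)
  obtain ⟨Y, hY⟩ := hM hAs
  exact hY.measure_disjoint_eq_of_limits huniq hAs hΦ hd
    (sle_restrictionDeriv_frequently_gt_of_isPlusHull_or_isMinusHull h62 hgen h₆ htr hswallow hA')
    (sle_restrictionDeriv_frequently_lt_of_vanishesAtHit hgen h₆ hswallow hAs (h63 hA hAs))

/-! ### [LSW] Thm. 6.1 for all hulls of `𝒬₊ ∪ 𝒬₋`, by smooth approximation -/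

/-- **For a simple transient path from `0`, avoiding `A` means avoiding some `J n`** when
smooth hulls `J n` decrease to a set `F ⊇ A` with `F ∩ ℍ ⊆ A` and `0 ∉ F`: the path meets `F`
only through `A` (its points at positive times lie in `ℍ`, its starting point is `0 ∉ F`), a
compact initial arc missing `F = ⋂ J n` misses some `J n` (`eventually_disjoint_of_iInter_eq`),
and the far part of the path lies outside a disc containing `J 0 ⊇ J n`. [folklore] -/
theorem exists_disjoint_of_disjoint_of_iInter_eq {γ : ℝ≥0 → ℂ} (hγ : Continuous γ)
    (h0 : γ 0 = 0) (hs : Loewner.IsSimpleTrace γ) (htr : Tendsto (fun t ↦ ‖γ t‖) atTop atTop)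
    {J : ℕ → Set ℂ} {F : Set ℂ} (hJc : ∀ n, IsClosed (J n)) (hJb : Bornology.IsBounded (J 0))
    (hJm : Antitone J) (hJi : (⋂ n, J n) = F) (hFA : F ∩ upperHalfPlaneSet ⊆ A) (h0F : (0 : ℂ) ∉ F)
    (hdisj : Disjoint (range γ) A) : ∃ n, Disjoint (range γ) (J n) := by
  -- the path misses `F`
  have hγF : Disjoint (range γ) F := by
    refine Set.disjoint_left.2 ?_
    rintro _ ⟨t, rfl⟩ htF
    rcases eq_or_ne t 0 with rfl | ht0
    · exact h0F (h0 ▸ htF)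
    · exact Set.disjoint_left.1 hdisj (mem_range_self t)
        (hFA ⟨htF, hs.2 t (pos_iff_ne_zero.2 ht0)⟩)
  -- a disc containing `J 0` and a time after which the path is outside it
  obtain ⟨R, hR⟩ := hJb.subset_ball 0
  obtain ⟨s₁, hs₁⟩ : ∃ s₁ : ℝ≥0, ∀ s, s₁ ≤ s → R < ‖γ s‖ := by
    have := htr.eventually (eventually_gt_atTop R)
    rw [eventually_atTop] at this
    exact this
  -- the initial arc eventually misses `J n`
  have hC : IsCompact (γ '' Icc 0 s₁) := isCompact_Icc.image hγ
  have hCF : Disjoint (γ '' Icc 0 s₁) F := hγF.mono_left (image_subset_range _ _)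
  obtain ⟨n, hn⟩ := (eventually_disjoint_of_iInter_eq hJc hJm hJi hC hCF).exists
  refine ⟨n, Set.disjoint_left.2 ?_⟩
  rintro _ ⟨s, rfl⟩ hsJ
  rcases le_or_gt s s₁ with hle | hlt
  · exact Set.disjoint_left.1 hn ⟨s, ⟨bot_le, hle⟩, rfl⟩ hsJ
  · have h1 := hR (hJm (Nat.zero_le n) hsJ)
    rw [mem_ball, dist_zero_right] at h1
    exact lt_irrefl _ ((hs₁ s hlt.le).trans h1)

/-- **Thm. 6.1 along a smooth approximation**: if `A ∈ 𝒬*` has a smooth one-sided outer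
approximation `J n ↓ F` with `Φ'_{J n}(0) → Φ'_A(0)` (`HasSmoothApprox`), then
`P[γ ∩ A = ∅] = Φ'_A(0)^{5/8}`: the events `{γ ∩ J n = ∅}` increase, their union is
`{γ ∩ A = ∅}` up to a null set (`exists_disjoint_of_disjoint_of_iInter_eq` on the almost sure
event where the trace is simple and transient), and their probabilities `Φ'_{J n}(0)^{5/8}`
(Thm. 6.1 for smooth hulls) converge to `Φ'_A(0)^{5/8}`. This is the reduction "by Prop. 3.3
[(4) ⇒ (3), using Lemma 2.1]" of the printed proof, for one-sided hulls.
[cite: LawlerSchrammWerner2003Restriction, proof of Thm. 6.1 (§6) with Prop. 3.3 (4) ⇒ (3) and Lemma 2.1] -/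
theorem sle_measure_disjoint_eq_of_hasSmoothApprox [Fact Process.isProjectiveLimit_preWienerMeasure]
    (huniq : IsStarHull.existsUnique_isRestrictionMap) (hex : IsStarHull.exists_hasRestrictionDeriv)
    (hM : sle_exists_isRestrictionMartingale)
    (h62 : Loewner.restrictionDeriv_exitTime_gt) (h63 : IsSmoothHull.restrictionDerivVanishesAtHit)
    (hgen : HasSLETrace ((8 : ℝ≥0) / 3))
    (h₆ : RandomPlanarGeometry.ae_isSimpleTrace_sleTrace_of_le_four (κ := (8 : ℝ≥0) / 3))
    (htr : tendsto_norm_sleTrace_atTop) (hswallow : sle_swallowingTime_ofReal_eq_firstHit)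
    (happ : HasSmoothApprox A)
    {Φ : ConformalEquiv (upperHalfPlaneSet \ A) upperHalfPlaneSet} (hΦ : IsRestrictionMap A Φ)
    {d : ℝ} (hd : HasRestrictionDeriv A Φ d) :
    Process.preWienerMeasure {ω | Disjoint (range (sleTrace ((8 : ℝ≥0) / 3) ω)) A} =
      ENNReal.ofReal (d ^ ((5 : ℝ) / 8)) := by
  obtain ⟨J, F, hJs, hJpm, hJm, hJi, hAF, hFA, h0F, hconv⟩ := happ
  have hJst : ∀ n, IsStarHull (J n) := fun n ↦ (hJpm n).elim (fun h ↦ h.1) (fun h ↦ h.1)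
  -- restriction data of the `J n`
  have hdata : ∀ n, ∃ (Ψ : ConformalEquiv (upperHalfPlaneSet \ J n) upperHalfPlaneSet) (e : ℝ),
      IsRestrictionMap (J n) Ψ ∧ HasRestrictionDeriv (J n) Ψ e := fun n ↦ by
    obtain ⟨Ψ, hΨ, -⟩ := huniq (hJst n)
    obtain ⟨e, -, -, he⟩ := hex (hJst n) hΨ
    exact ⟨Ψ, e, hΨ, he⟩
  choose Ψ dn hΨ hdn using hdata
  have hlim : Tendsto dn atTop (𝓝 d) := hconv Φ Ψ d dn hΦ hd hΨ hdn
  -- the increasing events `{γ ∩ J n = ∅}`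
  set γ : (ℝ≥0 → ℝ) → ℝ≥0 → ℂ := fun ω ↦ sleTrace ((8 : ℝ≥0) / 3) ω with hγdef
  set E : ℕ → Set (ℝ≥0 → ℝ) := fun n ↦ {ω | Disjoint (range (γ ω)) (J n)} with hE
  have hEn : ∀ n, Process.preWienerMeasure (E n) = ENNReal.ofReal (dn n ^ ((5 : ℝ) / 8)) := fun n ↦
    sle_measure_disjoint_eq_of_isSmoothHull huniq hM h62 h63 hgen h₆ htr hswallow (hJs n) (hJpm n)
      (hΨ n) (hdn n)
  have hmono : Monotone E := fun m n hmn ω hω ↦ Disjoint.mono_right (hJm hmn) hω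
  have h1 : Tendsto (Process.preWienerMeasure ∘ E) atTop (𝓝 (Process.preWienerMeasure (⋃ n, E n))) :=
    tendsto_measure_iUnion_atTop hmono
  have h2 : Tendsto (Process.preWienerMeasure ∘ E) atTop (𝓝 (ENNReal.ofReal (d ^ ((5 : ℝ) / 8)))) := by
    have : Process.preWienerMeasure ∘ E = fun n ↦ ENNReal.ofReal (dn n ^ ((5 : ℝ) / 8)) := funext hEn
    rw [this]
    exact ENNReal.tendsto_ofReal (hlim.rpow_const (Or.inr (by norm_num)))
  have hU : Process.preWienerMeasure (⋃ n, E n) = ENNReal.ofReal (d ^ ((5 : ℝ) / 8)) :=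
    tendsto_nhds_unique h1 h2
  -- `{γ ∩ A = ∅} = ⋃ₙ {γ ∩ J n = ∅}` almost surely
  have hκ0 : (0 : ℝ≥0) < 8 / 3 := by positivity
  have hκ4 : (8 : ℝ≥0) / 3 ≤ 4 := by
    rw [div_le_iff₀ (by norm_num : (0 : ℝ≥0) < 3)]
    norm_num
  have hae : {ω | Disjoint (range (γ ω)) A} =ᵐ[Process.preWienerMeasure] ⋃ n, E n := by
    refine Filter.eventuallyEq_set.2 ?_
    filter_upwards [ae_isGeneratedByCurve_sleTrace hgen, h₆ hκ0 hκ4, htr hκ0] with ω hgenω hsω htrω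
    simp only [mem_setOf_eq, mem_iUnion, hE]
    constructor
    · intro hω
      have h00 : γ ω 0 = 0 := by
        show sleTrace ((8 : ℝ≥0) / 3) ω 0 = 0
        rw [hgenω.apply_zero, sleDriving_zero, Complex.ofReal_zero]
      exact exists_disjoint_of_disjoint_of_iInter_eq hgenω.continuous h00 hsω htrω
        (fun n ↦ (hJst n).isBoundedHull.isClosed) (hJst 0).isBoundedHull.1 hJm hJi hFA h0F hω
    · rintro ⟨n, hn⟩
      exact hn.mono_right (hAF.trans (hJi ▸ iInter_subset J n))
  rw [measure_congr hae, hU]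

/-- **[LSW] Thm. 6.1 for every `A ∈ 𝒬₊ ∪ 𝒬₋`**: `P[γ[0,∞) ∩ A = ∅] = Φ'_A(0)^{5/8}`, from
the smooth case by Lemma 2.1 (`h21`; for `𝒬₋` by symmetry); the empty hull (`Φ_∅ = id`,
`Φ'_∅(0) = 1`, probability `1`) is immediate.
[cite: LawlerSchrammWerner2003Restriction, Thm. 6.1 and its proof (§6), one-sided hulls] -/
theorem sle_measure_disjoint_eq_of_isPlusHull_or_isMinusHull [Fact Process.isProjectiveLimit_preWienerMeasure]
    (huniq : IsStarHull.existsUnique_isRestrictionMap) (hex : IsStarHull.exists_hasRestrictionDeriv)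
    (hM : sle_exists_isRestrictionMartingale)
    (h62 : Loewner.restrictionDeriv_exitTime_gt) (h63 : IsSmoothHull.restrictionDerivVanishesAtHit)
    (h21 : IsPlusHull.exists_antitone_isSmoothHull) (hgen : HasSLETrace ((8 : ℝ≥0) / 3))
    (h₆ : RandomPlanarGeometry.ae_isSimpleTrace_sleTrace_of_le_four (κ := (8 : ℝ≥0) / 3))
    (htr : tendsto_norm_sleTrace_atTop) (hswallow : sle_swallowingTime_ofReal_eq_firstHit)
    (hA : IsPlusHull A ∨ IsMinusHull A)
    {Φ : ConformalEquiv (upperHalfPlaneSet \ A) upperHalfPlaneSet} (hΦ : IsRestrictionMap A Φ)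
    {d : ℝ} (hd : HasRestrictionDeriv A Φ d) :
    Process.preWienerMeasure {ω | Disjoint (range (sleTrace ((8 : ℝ≥0) / 3) ω)) A} =
      ENNReal.ofReal (d ^ ((5 : ℝ) / 8)) := by
  rcases A.eq_empty_or_nonempty with rfl | hne
  · -- the empty hull
    have hd1 : d = 1 :=
      HasRestrictionDeriv.eq_of_isRestrictionMap huniq isStarHull_empty isRestrictionMap_empty hΦ
        hasRestrictionDeriv_empty hd
    subst hd1
    simp [Real.one_rpow]
  · exact sle_measure_disjoint_eq_of_hasSmoothApprox huniq hex hM h62 h63 hgen h₆ htr hswallow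
      (hasSmoothApprox_of_plus_or_minus h21 hA hne) hΦ hd

/-! ### Non-vacuity: the closed upper half-disc is a smooth `+`-hull -/

/-- **The closed upper half-disc `{|z − 2| ≤ 1, Im z ≥ 0}` is a smooth hull** (non-vacuity of
`IsSmoothHull` and of the hypotheses of `IsSmoothHull.restrictionDerivVanishesAtHit` and
`IsPlusHull.exists_antitone_isSmoothHull`; it is a nonempty `+`-hull by
`isPlusHull_upperHalfDisc`, `upperHalfDisc_nonempty`): the arc `t ↦ 2 + e^{iπ(1−t)}` has the
continuous velocity `−πi e^{iπ(1−t)} ≠ 0`; injectivity on `[0, 1]` and `ℍ ∩ ∂D = γ(0,1)` as in the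
tree's `isArcHull_upperHalfDisc` (`HullApproximation`). [folklore] -/
theorem isSmoothHull_upperHalfDisc : IsSmoothHull upperHalfDisc := by
  -- the velocity `γ' t = e^{iπ(1-t)} · (π(0-1)) i`
  set γ' : ℝ → ℂ := fun t ↦
    Complex.exp ((Real.pi * (1 - t) : ℝ) * Complex.I) * ((((Real.pi * (0 - 1) : ℝ)) : ℂ) * Complex.I)
    with hγ'
  have hd : ∀ t, HasDerivAt halfDiscArc (γ' t) t := by
    intro t
    unfold halfDiscArc
    have h1 : HasDerivAt (fun s : ℝ ↦ (Real.pi * (1 - s) : ℝ)) (Real.pi * (0 - 1)) t :=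
      ((hasDerivAt_const t (1:ℝ)).sub (hasDerivAt_id t)).const_mul Real.pi
    have h2 : HasDerivAt (fun s : ℝ ↦ ((Real.pi * (1 - s) : ℝ) : ℂ) * Complex.I)
        ((((Real.pi * (0 - 1) : ℝ)) : ℂ) * Complex.I) t :=
      (h1.ofReal_comp).mul_const Complex.I
    exact (h2.cexp).const_add 2
  have hγ'c : Continuous γ' := by
    rw [hγ']
    fun_prop
  refine ⟨isArcHull_upperHalfDisc.isBoundedHull, halfDiscArc, γ', fun t _ ↦ (hd t).hasDerivWithinAt,
    hγ'c.continuousOn, ?_, ?_, ?_, ?_, ?_, ?_⟩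
  · -- regular: `γ' t ≠ 0`
    intro t _
    rw [hγ']
    apply mul_ne_zero (Complex.exp_ne_zero _)
    apply mul_ne_zero _ Complex.I_ne_zero
    norm_num [Real.pi_ne_zero]
  · -- injectivity of the arc on `[0, 1]` (as in `isArcHull_upperHalfDisc`)
    intro s hs t ht hst
    have h1 : Complex.exp ((Real.pi * (1 - s) : ℝ) * Complex.I) = Complex.exp ((Real.pi * (1 - t) : ℝ) * Complex.I) := by
      simpa [halfDiscArc] using hst
    obtain ⟨n, hn⟩ := Complex.exp_eq_exp_iff_exists_int.1 h1
    have hn' : Real.pi * (1 - s) = Real.pi * (1 - t) + n * (2 * Real.pi) := by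
      have := congrArg Complex.im hn
      simpa using this
    have hts : t - s = 2 * n := by
      have hpi : Real.pi ≠ 0 := Real.pi_ne_zero
      have : Real.pi * (t - s) = Real.pi * (2 * n) := by linarith
      exact mul_left_cancel₀ hpi this
    have hn0 : n = 0 := by
      have h2 : |(2 * n : ℝ)| ≤ 1 := by
        rw [← hts, abs_sub_le_iff]
        exact ⟨by linarith [hs.1, ht.2], by linarith [hs.2, ht.1]⟩
      have h3 : |(n : ℝ)| < 1 := by
        rw [abs_mul] at h2
        norm_num at h2
        linarith [abs_nonneg (n : ℝ)]
      exact Int.abs_lt_one_iff.1 (by exact_mod_cast h3)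
    rw [hn0] at hts
    simp at hts
    linarith
  · rw [halfDiscArc_im]; simp
  · rw [halfDiscArc_im]; simp
  · intro t ht
    rw [halfDiscArc_im]
    exact Real.sin_pos_of_pos_of_lt_pi (by nlinarith [Real.pi_pos, ht.2]) (by nlinarith [Real.pi_pos, ht.1])
  · rw [upperHalfPlaneSet_inter_frontier_upperHalfDisc]
    ext w
    constructor
    · rintro ⟨hw, hws⟩
      have hw0 : (0 : ℝ) < w.im := hw
      rw [mem_sphere, dist_eq_norm] at hws
      have hwim : (w - 2).im = w.im := by simp
      have hθ0 : 0 < Complex.arg (w - 2) := by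
        rcases (Complex.arg_nonneg_iff.2 (by rw [hwim]; exact hw0.le)).lt_or_eq with h | h
        · exact h
        · exfalso
          have := (Complex.arg_eq_zero_iff.1 h.symm).2
          rw [hwim] at this
          linarith
      have hθπ : Complex.arg (w - 2) < Real.pi :=
        Complex.arg_lt_pi_iff.2 (Or.inr (by rw [hwim]; exact hw0.ne'))
      refine ⟨1 - Complex.arg (w - 2) / Real.pi, ⟨by
        rw [sub_pos, div_lt_one Real.pi_pos]; exact hθπ, by
        have : 0 < Complex.arg (w - 2) / Real.pi := div_pos hθ0 Real.pi_pos
        linarith⟩, ?_⟩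
      have hexp := Complex.norm_mul_exp_arg_mul_I (w - 2)
      rw [hws, Complex.ofReal_one, one_mul] at hexp
      rw [halfDiscArc, show Real.pi * (1 - (1 - Complex.arg (w - 2) / Real.pi)) = Complex.arg (w - 2) by
        field_simp; ring, hexp]
      ring
    · rintro ⟨t, ht, rfl⟩
      refine ⟨?_, halfDiscArc_mem_sphere t⟩
      show 0 < (halfDiscArc t).im
      rw [halfDiscArc_im]
      exact Real.sin_pos_of_pos_of_lt_pi (by nlinarith [Real.pi_pos, ht.2]) (by nlinarith [Real.pi_pos, ht.1])

end Literature.Probability.RandomPlanarGeometry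

end
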